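import Summits.AtomisticToContinuum.Crystallization.Theses.SpectralChargeLedger
import Summits.AtomisticToContinuum.Crystallization.Theses.PhononSlackCertificates
import Summits.AtomisticToContinuum.Crystallization.Theorems.ChargedEnergyGap.Negative.BlocksBound
import Summits.AtomisticToContinuum.Crystallization.Theorems.SpectralChargeLedgerSummedShellPricingEquivalences

/-!
# Crux `SpectralChargeLedger.SummedShellPricing` (K1, stmt-AtomisticToContinuum-17044) —
# alternative line `hcp-relative-ledger` (crux-strategist, gen 1)

**Idea.**  The live line `Sketch` has exactly two open stubs: the hub crux `CoerciveTwoShellGap`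
(stmt-13956) and the core `stub_torusCoercivity`, which prices τ-bad-but-two-shell-good ("mild") motif
sites of a periodic configuration against the periodic infimum `e⋆ = ⨅_Q e(Q)` with an allowance for
two-shell-bad ("gross") sites.  Its lead records the core as stuck because "it needs e⋆ = e(relaxed hcp)
to the polytype scale 7·10⁻⁵" and because no Lean refutation is possible (a violator must be certified
BELOW e⋆ + κρ, and the tree bounds e⋆ only from above).

This line RE-TYPES the core so that `e⋆` disappears: the reference energy is the energy per particle of
the relaxed hcp crystal `hcpPeriodicConfiguration a₀ h₀` AT THE SAME existential cell `(a₀, h₀)` that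
defines τ-goodness.  Since `e⋆ ≤ e(hcp(a₀,h₀))` (`eStar_le`), the relative ledger implies the core
outright; conversely, in the only world in which the route can succeed (13956 ∧ K1 force the periodic
minimisers to be exactly Barlow-shelled at `(a₀,h₀)`, `stub_periodicMinimisersExact`, p168527) the two
are equivalent — no plausibility is spent.  What is gained: (i) the residual is a statement about the
Lennard-Jones landscape RELATIVE TO AN EXPLICIT CONFIGURATION — uniform exact-cell coercivity of the
close-packed family, the genre of Friesecke–Theil / E–Ming / Hudson–Ortner with certified lattice sums —
and needs no global lower bound at all; (ii) it is refutable in Lean by an explicit periodic competitor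
(both sides are certified-computable lattice sums), so the standing disprover gets a target with teeth;
(iii) its cell is pinned to `argmin e(hcp(a,h))`, certified in the tree at `(0.97129, 0.79294) ± 10⁻⁴`
(`HcpLandscapeGapBirth.stub_boxMinimiserRigid`), inside K1's box.

The analytic core is stated in the INTERIOR form its proof produces (`stub_interiorLedger`: only motif
sites whose whole `R`-neighbourhood is two-shell-good are priced; every site within `R` of a two-shell-bad
point is given the flat allowance), and the passage from "within `R` of a gross point" to "gross motif
sites" is a separate, purely geometric packing lemma on periodic configurations (`stub_spoiledByGross`).
Composition: `stub_interiorLedger ∧ stub_spoiledByGross ⇒ HcpRelativeLedger ⇒ core`, then the LANDED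
glue of the live line (`summedShellPricing_of_coerciveTwoShellGap_of_torusCoercivity`, p167766: torus
glue p166291, hub-crux torus form p101526, periodisation p166315, separation reduction p166632) closes
K1 BY NAME from `stub_coerciveTwoShellGap`.

Disproof used (Cruxes/SummedShellPricing/Disproof.lean): the cell stays EXISTENTIAL and is forced to the
exact relaxed-hcp optimum (`not_summedShellPricing_forall_cells`; at a non-optimal cell the reference
carries residual stress and the interior ledger is false by the dilation family, `energy_dilate_hcp`);
`c = c(τ)` is chosen after `τ` (`not_uniformKappa`, `not_linearKappa`; any proof gives `c(τ) = O(τ²)`,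
`kappa_le_of_pricingClause`); `τ > 0` (`summedShellPricing_false_without_tauPos`); separation is a
hypothesis of every stub (`summedShellPricing_false_without_separation`); only BAD sites are priced
(`summedShellPricing_false_without_bad`).  No sitewise multiplier appears (negative edge
`OneMultiplierPricing`, stmt-17253): both new stubs are SUMMED statements with configuration-dependent
bookkeeping.
-/

namespace Summit.AtomisticToContinuum.Crystallization.Cruxes.SummedShellPricing.HcpRelativeLedger

open scoped BigOperators Classical
open Literature.MathematicalPhysics.StatisticalMechanics Literature.Geometry.DiscreteGeometry
open Summit.AtomisticToContinuum.Crystallization.Theorems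
open Summit.AtomisticToContinuum.Crystallization.Theorems.ChargedEnergyGapNegative (eStar_le)

/-- **τ-good first shell at the cell `(a₀, h₀)`** — verbatim the disjunction of K1 / of the core stub of
line `Sketch`: the open punctured `13/10·a₀`-shell of `q` in `S` is matched, after a linear isometry and a
bijection, within `τ` to the 12-shell of `hcpStacking a₀ h₀` or of `fccStacking a₀ h₀`. [folklore] -/
def GoodShell (a₀ h₀ τ : ℝ) (S : Set (EuclideanSpace ℝ (Fin 3))) (q : EuclideanSpace ℝ (Fin 3)) : Prop :=
  ∃ A : EuclideanSpace ℝ (Fin 3) →ₗᵢ[ℝ] EuclideanSpace ℝ (Fin 3),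
    (∃ e : ↥{z : EuclideanSpace ℝ (Fin 3) | z ∈ S ∧ z ≠ q ∧ dist z (q) < 13 / 10 * a₀} ≃
        ↥{p : EuclideanSpace ℝ (Fin 3) | p ∈ hcpStacking a₀ h₀ ∧ p ≠ 0 ∧ ‖p‖ < 13 / 10 * a₀},
      ∀ t : ↥{z : EuclideanSpace ℝ (Fin 3) | z ∈ S ∧ z ≠ q ∧ dist z (q) < 13 / 10 * a₀},
        dist ((t : EuclideanSpace ℝ (Fin 3)) - q)
          (A ((e t : ↥{p : EuclideanSpace ℝ (Fin 3) | p ∈ hcpStacking a₀ h₀ ∧ p ≠ 0 ∧ ‖p‖ < 13 / 10 * a₀}) : EuclideanSpace ℝ (Fin 3))) ≤ τ) ∨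
    (∃ e : ↥{z : EuclideanSpace ℝ (Fin 3) | z ∈ S ∧ z ≠ q ∧ dist z (q) < 13 / 10 * a₀} ≃
        ↥{p : EuclideanSpace ℝ (Fin 3) | p ∈ fccStacking a₀ h₀ ∧ p ≠ 0 ∧ ‖p‖ < 13 / 10 * a₀},
      ∀ t : ↥{z : EuclideanSpace ℝ (Fin 3) | z ∈ S ∧ z ≠ q ∧ dist z (q) < 13 / 10 * a₀},
        dist ((t : EuclideanSpace ℝ (Fin 3)) - q)
          (A ((e t : ↥{p : EuclideanSpace ℝ (Fin 3) | p ∈ fccStacking a₀ h₀ ∧ p ≠ 0 ∧ ‖p‖ < 13 / 10 * a₀}) : EuclideanSpace ℝ (Fin 3))) ≤ τ)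

set_option linter.dupNamespace false in
/-- **The line's thesis `HcpRelativeLedger` (the e⋆-free core).**  One cell `(a₀,h₀)` in K1's box (with
`a₀, h₀ ≠ 0`, so that the relaxed hcp crystal `hcpPeriodicConfiguration` is available), an allowance
`C ≥ 0`, and for every `τ ∈ (0,1]` a price `c > 0` such that for every periodic `P` with `1/3`-separated
points: `c·#{mild} − C·#{gross} ≤ #motif·(e(P) − e(hcp(a₀,h₀)))`, mild = τ-bad at `(a₀,h₀)` but
`1/20`-two-shell-good, gross = not `1/20`-two-shell-good.  It is the core stub of line `Sketch` with the
periodic infimum `e⋆` replaced by the EXPLICIT reference `e(hcp(a₀,h₀)) ≥ e⋆`. [folklore] -/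
def HcpRelativeLedger : Prop :=
  ∃ (a₀ h₀ : ℝ) (ha : a₀ ≠ 0) (hh : h₀ ≠ 0), 47 / 50 ≤ a₀ ∧ a₀ ≤ 1 ∧ |h₀ - a₀ * Real.sqrt (2 / 3)| ≤ a₀ / 100 ∧
    ∃ C : ℝ, 0 ≤ C ∧ ∀ τ : ℝ, 0 < τ → τ ≤ 1 → ∃ c : ℝ, 0 < c ∧
      ∀ P : PeriodicConfiguration 3, (∀ u ∈ P.points, ∀ v ∈ P.points, u ≠ v → (1 / 3 : ℝ) ≤ dist u v) →
        c * ((P.motif.filter fun q => ¬ GoodShell a₀ h₀ τ P.points q ∧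
              IsTwoShellGoodSet (1 / 20) (47 / 50) 1 P.points q).card : ℝ)
          - C * ((P.motif.filter fun q => ¬ IsTwoShellGoodSet (1 / 20) (47 / 50) 1 P.points q).card : ℝ)
        ≤ (P.motif.card : ℝ) *
            (P.energyPerParticle lennardJones - (hcpPeriodicConfiguration ha hh).energyPerParticle lennardJones)

/-! ## The stubs -/

/-- **Stub 0 — the hub crux** `PhononSlackCertificates.CoerciveTwoShellGap` (stmt-AtomisticToContinuum-13956;
shared with line `Sketch`, staffed by its own line, equivalent to the torus two-shell gap at tolerance
`1/20`, p101526).  An existing statement item, not re-typed. [folklore] -/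
theorem stub_coerciveTwoShellGap :
    Summit.AtomisticToContinuum.Crystallization.Theses.PhononSlackCertificates.CoerciveTwoShellGap := by
  sorry

/-- **Stub 1 — INTERIOR RELATIVE LEDGER (XL; the e⋆-free analytic core).**  There are a cell `(a₀,h₀)`
in K1's box, a depth `R > 0` and an allowance `C ≥ 0`, and for every `τ ∈ (0,1]` a price `c > 0`, such
that for every periodic `P` with `1/3`-separated points
`c·#{q ∈ motif : q is τ-bad at (a₀,h₀) and EVERY point of P within R of q is 1/20-two-shell-good}
 − C·#{q ∈ motif : SOME point of P within R of q is not 1/20-two-shell-good}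
 ≤ #motif·(e(P) − e(hcpPeriodicConfiguration a₀ h₀))`.
Content: on the `R`-interior of the two-shell-good region the configuration is locally a strained
Barlow stacking (18-point charts); its energy relative to the relaxed hcp reference at the OPTIMAL cell
(zero residual stress ⇒ the linear boundary-flux terms vanish) is bounded below by a uniform quadratic
form in the local distortion (Hägg domination `LjRegistryDomination`, stmt-3063, PROVED, orders the
words at fixed cell; certified cell Hessian `≈ diag(10.3, 30.7)`; uniform polytype phonon stability,
cf. stmt-15800) while every cross term with gross matter is summable (`r⁻⁶` tail, `1/3`-separation) and
charged to the allowance; τ-badness at the exact cell forces local distortion `≥ τ/L`, so `c(τ) ≍ τ²`,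
matching the disprover's tightness `κ ≤ 324(−e⋆)(τ/a₀)²`.  Why it might fail: a soft relative mode of
some relaxed polytype or a second basin inside the 5 % two-shell tube (the energy is then not coercive
relative to the layered family), or hcp(a₀,h₀) is NOT minimal among two-shell-good periodic
configurations (a strained/defected Barlow variant beats it) — each would be an explicit, certifiable
periodic competitor. [folklore] -/
theorem stub_interiorLedger :
    ∃ (a₀ h₀ : ℝ) (ha : a₀ ≠ 0) (hh : h₀ ≠ 0), 47 / 50 ≤ a₀ ∧ a₀ ≤ 1 ∧ |h₀ - a₀ * Real.sqrt (2 / 3)| ≤ a₀ / 100 ∧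
      ∃ R : ℝ, 0 < R ∧ ∃ C : ℝ, 0 ≤ C ∧ ∀ τ : ℝ, 0 < τ → τ ≤ 1 → ∃ c : ℝ, 0 < c ∧
        ∀ P : PeriodicConfiguration 3, (∀ u ∈ P.points, ∀ v ∈ P.points, u ≠ v → (1 / 3 : ℝ) ≤ dist u v) →
          c * ((P.motif.filter fun q => ¬ GoodShell a₀ h₀ τ P.points q ∧
                ∀ p ∈ P.points, dist p q ≤ R → IsTwoShellGoodSet (1 / 20) (47 / 50) 1 P.points p).card : ℝ)
            - C * ((P.motif.filter fun q =>
                ∃ p ∈ P.points, dist p q ≤ R ∧ ¬ IsTwoShellGoodSet (1 / 20) (47 / 50) 1 P.points p).card : ℝ)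
          ≤ (P.motif.card : ℝ) *
              (P.energyPerParticle lennardJones - (hcpPeriodicConfiguration ha hh).energyPerParticle lennardJones) := by
  sorry

/-- **Stub 2 — SPOILED-BY-GROSS PACKING LEMMA (M; pure geometry of periodic configurations).**  For every
depth `R > 0` there is `K ≥ 0` such that in every periodic `P` with `1/3`-separated points the number of
motif sites within distance `R` of SOME two-shell-bad point of `P.points` is at most `K` times the number
of two-shell-bad MOTIF sites.  Proof sketch: a bad point `p = g + λ` (`g ∈ motif`, `λ ∈ lattice`) has a bad
representative `g` (goodness is covariant under the period lattice, `P.points + λ = P.points`); for fixed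
`g` the motif sites `q` with `dist (g + λ) q ≤ R` for some `λ` inject (`q ↦ q − λ`, distinct
representatives `eq_of_sub_mem`) into `P.points ∩ B̄_R(g)`, which has at most `K = (6R + 1)³` points by
`1/3`-separation. [folklore] -/
theorem stub_spoiledByGross :
    ∀ R : ℝ, 0 < R → ∃ K : ℝ, 0 ≤ K ∧
      ∀ P : PeriodicConfiguration 3, (∀ u ∈ P.points, ∀ v ∈ P.points, u ≠ v → (1 / 3 : ℝ) ≤ dist u v) →
        ((P.motif.filter fun q =>
            ∃ p ∈ P.points, dist p q ≤ R ∧ ¬ IsTwoShellGoodSet (1 / 20) (47 / 50) 1 P.points p).card : ℝ)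
          ≤ K * ((P.motif.filter fun q => ¬ IsTwoShellGoodSet (1 / 20) (47 / 50) 1 P.points q).card : ℝ) := by
  sorry

/-! ## Composition (sorry-free) -/

/-- Interior ledger ∧ packing ⇒ the relative ledger: a mild site is either `R`-interior (priced by stub 1)
or within `R` of a gross point (counted by stub 2); take `c' = min c 1` and the τ-independent allowance
`C' = (C + 1)·K`. [folklore] -/
theorem hcpRelativeLedger_of
    (h₁ : ∃ (a₀ h₀ : ℝ) (ha : a₀ ≠ 0) (hh : h₀ ≠ 0), 47 / 50 ≤ a₀ ∧ a₀ ≤ 1 ∧ |h₀ - a₀ * Real.sqrt (2 / 3)| ≤ a₀ / 100 ∧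
      ∃ R : ℝ, 0 < R ∧ ∃ C : ℝ, 0 ≤ C ∧ ∀ τ : ℝ, 0 < τ → τ ≤ 1 → ∃ c : ℝ, 0 < c ∧
        ∀ P : PeriodicConfiguration 3, (∀ u ∈ P.points, ∀ v ∈ P.points, u ≠ v → (1 / 3 : ℝ) ≤ dist u v) →
          c * ((P.motif.filter fun q => ¬ GoodShell a₀ h₀ τ P.points q ∧
                ∀ p ∈ P.points, dist p q ≤ R → IsTwoShellGoodSet (1 / 20) (47 / 50) 1 P.points p).card : ℝ)
            - C * ((P.motif.filter fun q =>
                ∃ p ∈ P.points, dist p q ≤ R ∧ ¬ IsTwoShellGoodSet (1 / 20) (47 / 50) 1 P.points p).card : ℝ)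
          ≤ (P.motif.card : ℝ) *
              (P.energyPerParticle lennardJones - (hcpPeriodicConfiguration ha hh).energyPerParticle lennardJones))
    (h₂ : ∀ R : ℝ, 0 < R → ∃ K : ℝ, 0 ≤ K ∧
      ∀ P : PeriodicConfiguration 3, (∀ u ∈ P.points, ∀ v ∈ P.points, u ≠ v → (1 / 3 : ℝ) ≤ dist u v) →
        ((P.motif.filter fun q =>
            ∃ p ∈ P.points, dist p q ≤ R ∧ ¬ IsTwoShellGoodSet (1 / 20) (47 / 50) 1 P.points p).card : ℝ)
          ≤ K * ((P.motif.filter fun q => ¬ IsTwoShellGoodSet (1 / 20) (47 / 50) 1 P.points q).card : ℝ)) :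
    HcpRelativeLedger := by
  obtain ⟨a₀, h₀, ha, hh, hb1, hb2, hb3, R, hR, C, hC, hτ⟩ := h₁
  obtain ⟨K, hK, hpack⟩ := h₂ R hR
  refine ⟨a₀, h₀, ha, hh, hb1, hb2, hb3, (C + 1) * K, by positivity, ?_⟩
  intro τ hτ0 hτ1
  obtain ⟨c, hc, hP⟩ := hτ τ hτ0 hτ1
  refine ⟨min c 1, lt_min hc one_pos, ?_⟩
  intro P hsep
  have hL := hP P hsep
  have hSK := hpack P hsep
  -- names for the four finsets
  set IB := (P.motif.filter fun q => ¬ GoodShell a₀ h₀ τ P.points q ∧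
      ∀ p ∈ P.points, dist p q ≤ R → IsTwoShellGoodSet (1 / 20) (47 / 50) 1 P.points p) with hIB
  set Sp := (P.motif.filter fun q =>
      ∃ p ∈ P.points, dist p q ≤ R ∧ ¬ IsTwoShellGoodSet (1 / 20) (47 / 50) 1 P.points p) with hSp
  set G := (P.motif.filter fun q => ¬ IsTwoShellGoodSet (1 / 20) (47 / 50) 1 P.points q) with hG
  set M := (P.motif.filter fun q => ¬ GoodShell a₀ h₀ τ P.points q ∧
      IsTwoShellGoodSet (1 / 20) (47 / 50) 1 P.points q) with hM
  -- a mild site is interior-bad or spoiled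
  have hsub : M ⊆ IB ∪ Sp := by
    intro q hq
    rw [hM, Finset.mem_filter] at hq
    rw [Finset.mem_union, hIB, hSp, Finset.mem_filter, Finset.mem_filter]
    by_cases hsp : ∃ p ∈ P.points, dist p q ≤ R ∧ ¬ IsTwoShellGoodSet (1 / 20) (47 / 50) 1 P.points p
    · exact Or.inr ⟨hq.1, hsp⟩
    · refine Or.inl ⟨hq.1, hq.2.1, ?_⟩
      intro p hp hpq
      by_contra hbad
      exact hsp ⟨p, hp, hpq, hbad⟩
  have hcardM : (M.card : ℝ) ≤ (IB.card : ℝ) + (Sp.card : ℝ) := by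
    have := (Finset.card_le_card hsub).trans (Finset.card_union_le IB Sp)
    exact_mod_cast this
  have hIB0 : (0 : ℝ) ≤ IB.card := by positivity
  have hSp0 : (0 : ℝ) ≤ Sp.card := by positivity
  have hG0 : (0 : ℝ) ≤ G.card := by positivity
  have hm0 : (0 : ℝ) ≤ P.motif.card := by positivity
  have hmin1 : min c 1 ≤ 1 := min_le_right _ _
  have hminc : min c 1 ≤ c := min_le_left _ _
  have hmin0 : 0 ≤ min c 1 := le_of_lt (lt_min hc one_pos)
  have hstar : (⨅ Q : PeriodicConfiguration 3, Q.energyPerParticle lennardJones)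
      ≤ (hcpPeriodicConfiguration ha hh).energyPerParticle lennardJones := eStar_le _
  have e1 : min c 1 * (M.card : ℝ) ≤ min c 1 * ((IB.card : ℝ) + (Sp.card : ℝ)) :=
    mul_le_mul_of_nonneg_left hcardM hmin0
  have e2 : min c 1 * (IB.card : ℝ) ≤ c * (IB.card : ℝ) := mul_le_mul_of_nonneg_right hminc hIB0
  have e3 : min c 1 * (Sp.card : ℝ) ≤ 1 * (Sp.card : ℝ) := mul_le_mul_of_nonneg_right hmin1 hSp0
  have e4 : C * (Sp.card : ℝ) ≤ C * (K * (G.card : ℝ)) := mul_le_mul_of_nonneg_left hSK hC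
  nlinarith [e1, e2, e3, e4, hL, hSK, hK, hC, hG0]

/-- The relative ledger implies the core stub of line `Sketch` (`stub_torusCoercivity`, e⋆-form):
`e⋆ ≤ e(hcp(a₀,h₀))` (`eStar_le`) and `#motif ≥ 0`. [folklore] -/
theorem torusCoercivity_of_hcpRelativeLedger (h : HcpRelativeLedger) :
    ∃ a₀ h₀ : ℝ, 47 / 50 ≤ a₀ ∧ a₀ ≤ 1 ∧ |h₀ - a₀ * Real.sqrt (2 / 3)| ≤ a₀ / 100 ∧
      ∃ C : ℝ, 0 ≤ C ∧ ∀ τ : ℝ, 0 < τ → τ ≤ 1 → ∃ c : ℝ, 0 < c ∧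
        ∀ P : PeriodicConfiguration 3, (∀ u ∈ P.points, ∀ v ∈ P.points, u ≠ v → (1 / 3 : ℝ) ≤ dist u v) →
          c * ((P.motif.filter fun q =>
              ¬ (∃ A : EuclideanSpace ℝ (Fin 3) →ₗᵢ[ℝ] EuclideanSpace ℝ (Fin 3),
                  (∃ e : ↥{z : EuclideanSpace ℝ (Fin 3) | z ∈ P.points ∧ z ≠ q ∧ dist z (q) < 13 / 10 * a₀} ≃
                      ↥{p : EuclideanSpace ℝ (Fin 3) | p ∈ hcpStacking a₀ h₀ ∧ p ≠ 0 ∧ ‖p‖ < 13 / 10 * a₀},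
                    ∀ t : ↥{z : EuclideanSpace ℝ (Fin 3) | z ∈ P.points ∧ z ≠ q ∧ dist z (q) < 13 / 10 * a₀},
                      dist ((t : EuclideanSpace ℝ (Fin 3)) - q)
                        (A ((e t : ↥{p : EuclideanSpace ℝ (Fin 3) | p ∈ hcpStacking a₀ h₀ ∧ p ≠ 0 ∧ ‖p‖ < 13 / 10 * a₀}) : EuclideanSpace ℝ (Fin 3))) ≤ τ) ∨
                  (∃ e : ↥{z : EuclideanSpace ℝ (Fin 3) | z ∈ P.points ∧ z ≠ q ∧ dist z (q) < 13 / 10 * a₀} ≃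
                      ↥{p : EuclideanSpace ℝ (Fin 3) | p ∈ fccStacking a₀ h₀ ∧ p ≠ 0 ∧ ‖p‖ < 13 / 10 * a₀},
                    ∀ t : ↥{z : EuclideanSpace ℝ (Fin 3) | z ∈ P.points ∧ z ≠ q ∧ dist z (q) < 13 / 10 * a₀},
                      dist ((t : EuclideanSpace ℝ (Fin 3)) - q)
                        (A ((e t : ↥{p : EuclideanSpace ℝ (Fin 3) | p ∈ fccStacking a₀ h₀ ∧ p ≠ 0 ∧ ‖p‖ < 13 / 10 * a₀}) : EuclideanSpace ℝ (Fin 3))) ≤ τ)) ∧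
              IsTwoShellGoodSet (1 / 20) (47 / 50) 1 P.points q).card : ℝ)
            - C * ((P.motif.filter fun q => ¬ IsTwoShellGoodSet (1 / 20) (47 / 50) 1 P.points q).card : ℝ)
          ≤ (P.motif.card : ℝ) * (P.energyPerParticle lennardJones - (⨅ Q : PeriodicConfiguration 3, Q.energyPerParticle lennardJones)) := by
  obtain ⟨a₀, h₀, ha, hh, hb1, hb2, hb3, C, hC, hτ⟩ := h
  refine ⟨a₀, h₀, hb1, hb2, hb3, C, hC, ?_⟩
  intro τ hτ0 hτ1
  obtain ⟨c, hc, hP⟩ := hτ τ hτ0 hτ1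
  refine ⟨c, hc, ?_⟩
  intro P hsep
  have hL := hP P hsep
  have hstar : (⨅ Q : PeriodicConfiguration 3, Q.energyPerParticle lennardJones)
      ≤ (hcpPeriodicConfiguration ha hh).energyPerParticle lennardJones := eStar_le _
  have hm0 : (0 : ℝ) ≤ P.motif.card := by positivity
  have hmono : (P.motif.card : ℝ) *
      (P.energyPerParticle lennardJones - (hcpPeriodicConfiguration ha hh).energyPerParticle lennardJones)
      ≤ (P.motif.card : ℝ) *
        (P.energyPerParticle lennardJones - (⨅ Q : PeriodicConfiguration 3, Q.energyPerParticle lennardJones)) :=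
    mul_le_mul_of_nonneg_left (by linarith) hm0
  exact hL.trans hmono

/-- **Composition**: the three stubs close the crux BY NAME — interior ledger ∧ packing ⇒ relative
ledger ⇒ core (e⋆-form), and hub crux ∧ core ⇒ K1 by the landed glue of line `Sketch` (p167766). -/
theorem SummedShellPricing_of :
    Summit.AtomisticToContinuum.Crystallization.Theses.SpectralChargeLedger.SummedShellPricing :=
  SummedShellPricingEquivalences.summedShellPricing_of_coerciveTwoShellGap_of_torusCoercivity
    stub_coerciveTwoShellGap
    (torusCoercivity_of_hcpRelativeLedger (hcpRelativeLedger_of stub_interiorLedger stub_spoiledByGross))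

/-- The same composition as an implication between the stub statements (hub crux → relative ledger → K1),
for the skeleton audit and for a future `--split … --glue-by`. [folklore] -/
theorem SummedShellPricing_of_coerciveTwoShellGap_of_hcpRelativeLedger :
    Summit.AtomisticToContinuum.Crystallization.Theses.PhononSlackCertificates.CoerciveTwoShellGap →
      HcpRelativeLedger →
        Summit.AtomisticToContinuum.Crystallization.Theses.SpectralChargeLedger.SummedShellPricing :=
  fun hgap hrel =>
    SummedShellPricingEquivalences.summedShellPricing_of_coerciveTwoShellGap_of_torusCoercivity hgap
      (torusCoercivity_of_hcpRelativeLedger hrel)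

end Summit.AtomisticToContinuum.Crystallization.Cruxes.SummedShellPricing.HcpRelativeLedger
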